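import Literature.MathematicalPhysics.QuantumFieldTheory.Balaban1983to89.B9Cor36GCubeLocAtMemberClosed
import Literature.MathematicalPhysics.QuantumFieldTheory.Balaban1983to89.B9Cor36BondSandwichTransferBlocks

/-!
# `Balaban1983to89.B9Cor36GCubeLocAtBlocks` — [Balaban1985BackgroundPropagators] COROLLARY 3.6 p. 408 AT ONE COVER CUBE, BOND SECTOR, READ ON ALL THE MEMBER's BLOCKS:
# the four (3.42) block majorants (Thm 3.3's reading «G′ ↦ G, λ ↦ J») of the cut transported bond cube letter of design (R) `O_□ = χ_□R(u_□)⁻¹G_□(Ṽ_□)R(u_□)χ_□`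
# (lit-balaban's `locLetterBY`, `GmemB`), with the MEMBER's covariant bond derivatives `∇_{U,ν}`, `∇*_{U,ν}`, `Δ_U`, over the ALL-BLOCKS geometry `geoBK i` keyed by
# the block `y(b₋) = blkV1 b` of the bond's initial point — from ONE cover cube's (3.35) datum, for EVERY member above one threshold (cornered members included; NO
# section `ιB`): the section-free twins of lit-balaban-p38's `B9Cor36GCubeLocAtMember.eBlock_locLetterBY` (flat right entry displayed) and of
# `B9Cor36GCubeLocAtMemberClosed.eBlock_locLetterBY''` (right entry discharged) stopped BEFORE the index-keyed writer — exactly the input tables h0–h3 of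
# dag-n06-c's `B9Local342GOfBlocksXBK` (rows 19 of the pub-ymgap N06 certificate, all members; LOCATED-28; dag-lead WORDS 317 (2)(i))

T. Bałaban, *Propagators for lattice gauge theories in a background field*, Commun. Math. Phys. **99** (1985) 389–434 [`Balaban1985BackgroundPropagators`, "B9"]
(held `paper:balaban1985-cmp99-background-propagators`; journal page = PDF page + 388; page owner r06); [4] = T. Bałaban, *Propagators and renormalization
transformations for lattice gauge theories. II*, Commun. Math. Phys. **96** (1984) 223–250 [`Balaban1984PropagatorsII`].

statement-level skeleton of published theorems with citation tags; proofs where landed; nothing here is a claim about the Yang–Mills mass gap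

THE PRINTED LOCI.  [B9] Cor. 3.6 p. 408 (AS PRINTED: «Corollary 3.6. If a configuration U satisfies (3.35) with O(1)Mα₀ ≦ α₁, and Ω′₀ ⊂ □̃ for a cube □ of the class described
in this condition, then Theorems 3.1–3.3 hold for the operators G′(U), (Q′(U)G′²(U)Q′*(U))⁻¹, G(U) constructed for the sequence {Ω′_j}. This follows from Corollary 3.5 applied
to the configuration U′ = U^u, and we have to recall only that all the results of these theorems are gauge invariant.»); Thm 3.3 p. 399 («with G′(U) replaced by G(U) and λ
replaced by a function J defined at bonds»); Thm 3.1 (3.42) p. 397 («y, y′ ∈ 𝔅»); (3.87)–(3.89) p. 409; p. 410 l. 14–15; (3.35) p. 396 (the per-cube gauge datum «there exists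
a gauge transformation u on □ such that U^u = e^{iηA}»); p. 393 l. 12–18 («Ω_j∖Ω_{j+1} = Bʲ(Λ_j)»).  [4] (2.51)–(2.55) p. 232, (2.45)–(2.46) p. 231, p. 248.

WHY THIS FILE.  p38's `eBlock_locLetterBY` proves, from one cover cube's (3.35) datum in G-F6a's form (plus the flat right entry `hR` of cell GAPS G-B9-02, later discharged by
`B9Cor36GCubeLocAtMemberClosed`), the four (3.42) bond block majorants of `O_□` with the member's derivatives — over node00-def-Y's INDEX-keyed geometry through a SECTION `ιB`
of `β`, then WRITES them into `EBlock (kernelFamilyBInv …)`.  At the cornered members no section exists; the all-members rows-19 currency is the BLOCK-keyed one of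
`B9Local342GOfBlocksXBK` ∕ `B9BlockKeyTransferXBK`.  THIS FILE is p38's theorem in that key, section-free:
* ★★★ `hasMajorant_locLetterBY_blocks` — the twin of `eBlock_locLetterBY` (flat right entry `hR` at `(B₂, ρ′)` displayed): `IsUnit Δ_{a,□}(Ṽ_□)` AND the four block
  majorants over `toB6 (geoBK i) Rr Hp` keyed `(b, j) ↦ y(b₋)` of `conj b (GmemB i □ u A)` (`= O_□`, `GmemB_apply`), `conj b (cdBₗ i U ν)·conj b (GmemB …)`,
  `conj b (GmemB …)·conj b (cdsBₗ i U ν)`, `conj b (lapBₗ i U)·conj b (GmemB …)` with kernels `B₀(1+B₂)·ℓ(a)^{2,1,1,0}·e^{−(1−9∕5000)ρ′d}` — LITERALLY the shapes h0–h3 of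
  `B9Local342GOfBlocksXBK` at `O □ := locLetterBY i □ parSymY parBY u χ_□ Ṽ_□`, `G := GmemB`, `D ν := cdBₗ i U ν`, `Ds ν := cdsBₗ i U ν`, `L := lapBₗ i U` (`cdBₗ_apply`,
  `cdsBₗ_apply`, `lapBₗ_apply`);
* ★★★ `hasMajorant_locLetterBY_blocks''` — the twin of `eBlock_locLetterBY''`: the flat right entry discharged by lit-balaban's `cor36_G_cube_rightEntry_at_locCfg'` (rate
  `ρ′ := min δ ρ_R`), NO displayed operator input.
PROOF: p38's, verbatim, with the section deleted — the Leibniz ∕ transport identities `cdBₗ_mul_GmemB`, `GmemB_mul_cdsBₗ`, `lapBₗ_mul_GmemB`, the multiplier sizes and supports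
(p38 ∕ p33 BY NAME), each term transferred by dag-n06-c's section-free `B9Cor36BondSandwichTransferBlocks`, G-F6a `cor36_G_cube_entries_at_locCfg'` as the input.

HONEST SCOPE ∕ NOT CLAIMED.  Composition of landed theorems; no estimate added.  DISPLAYED: the per-cube (3.35) datum in G-F6a's form (Hermitian type `‖e^{itA}‖ ≤ 1`,
`sRead C Λ ≤ a₁`), `u` bi-contractive, the member thresholds (existential).  «Cornered members» are OUR bookkeeping ([B7] (4) p. 18 ∕ [B9] p. 393 assume complete blocks;
lit-balaban OWNER WORD IR-N06-SECTION 2026-08-30: consumer-side object).  Sup-entries (3.42)₁₋₄ only, at ONE cube letter; the bond Hölder entries, the glueing (3.87)–(3.90),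
the fold into the N06 certificate are NOT here.  Count-neutral; rows 19 NOT thereby derived; N06 NOT discharged; nothing on `d = 4`, the continuum, reflection positivity,
the mass gap or Clay.  No `sorry`, no `axiom`, no `… : Prop` fact, no `instance`, no `notation`, no `def`.  NEW file; nothing landed is modified.  Cell `pub-ymgap` (D-0062),
seat `pub-ymgap-dag-n06-c` (gen 23), 2026-08-30; `--supports stmt-QuantumFields-27364`.  Net new unproved facts: 0.

RELATED IN THE TREE, NOT DUPLICATED (searched 2026-08-30: `rg` for the basename and the two decl names over `lean/Literature` + `lean/Summits` — 0 hits): p38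
`B9Cor36GCubeLocAtMember` ∕ `…Right` ∕ `…Closed` (index-keyed through `ιB`, written into `EBlock`; §1–§3 letters and identities USED BY NAME), dag-n06-c
`B9Cor36GpCubeLocAtBlocks` (the site-sector twin), `B9Local342GOfEBlockInvB` (the `EBlock`-currency bond bridge, SC members only).
-/

noncomputable section

namespace Literature.MathematicalPhysics.QuantumFieldTheory.Balaban1983to89.B9Cor36GCubeLocAtBlocks

open B4PartitionUnity22 (thetaProf D1 D2 D1_nonneg D2_nonneg contDiff_thetaProf hasCompactSupport_thetaProf)
open B6RandomWalk (HasMajorant hasMajorant_mono hasMajorant_add)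
open B9Thm34Ext (toB6)
open B9Ineq347 (ScaleTransfer)
open B9Eq39Adjoint (R R_zero R_smul covD fluct)
open B9Eq352DivFormLetters (conj conj_sub conj_neg)
open B9Eq352GradLetters (conj_add conj_finset_sum)
open B6KLevelCensusIndexV1 (KIdx kGeo)
open B6Cover236MultiLevelBlocks (cubes)
open B6GlobalChartV1 (PV boxEquiv blkV1)
open B9BackgroundsKLevelV1 (shiftsV1)
open B6Geom246MultiLevelBox (blkOf)
open B9Eq360DeltaPrimeAY (AfldY)
open B9Eq360DeltaPrimeACubeY (blkCubeY)
open B9CubeLettersBondOpsL0 (BlkCubeY deltaACubeY GACubeY)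
open B9CubeGeometryInputs (geoCK geoCK_len_pos geoCK_dist_axioms RM1 N1 hST_geoCK)
open B9CubeSequence408 (NearH)
open B9Thm37CubeCoverCommutators (cutMulY cutMulY_apply)
open B9Eq3104CutoffCommutators (hBdY hBdY_apply)
open B9Cor35GpCubeInputsAtOne (hasMajorant_neg)
open B9Cor35GCubeInputsAtOne (blkBK GVK)
open B9Cor35CinvAtCubeLetters (kernel_rate_mono)
open B9Cor36CubeCutoffs (SC NearC chiY locCfgY abs_chiY_le_one)
open B9Cor36GCubeLocLetter (locLetterBY)
open B9Cor36GCubeWindows (sRead)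
open B9Cor36GCubeEntriesAtV (cor36_G_cube_entries_at_locCfg')
open B9Cor36GCubeLocAtMemberClosed (cor36_G_cube_rightEntry_at_locCfg')
open B9Cor36GpCubeLocAtMember (agree_near nearC_of_chiY_ne_zero₃ hasMajorant_congr_op hasMajorant_finset_sum kernel_le)
open B9Cor36CutoffSecondDiff (chiY_weights nearH_of_chiY_ne_zero₃)
open B9Cor36GCubeLocAtMember (GinB GmemB SandB conj_GinB GmemB_apply cdBₗ_mul_GmemB GmemB_mul_cdsBₗ lapBₗ_mul_GmemB abs_cf_mul abs_cf_sq_mul)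
open B9CoReadingCoords (cdBₗ cdsBₗ lapBₗ cdBₗ_apply cdsBₗ_apply lapBₗ_apply)
open B9SectBAllBlocksGeometryY (geoBK geoBK_len_pos geoBK_dist_nonneg)
open B9Cor36BondSandwichTransferBlocks (hasMajorant_conj_bond_sandwich_decay_blocks hasMajorant_conj_bond_sandwich_decay_src_blocks)
open Node00 (SiteY FBondY CfgY GaugeY toKT shiftY gaugeY gBondY parSymY parBY UboxY conjY conjY_apply cdB cdsB lapB)
open Node00.OpsYNablaBridge (chartY)

variable {d ℓ : ℕ} {hd : 1 ≤ d + 1} {hL : Odd (ℓ + 1) ∧ 1 < ℓ + 1} {b₀ b₁ : ℝ}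
variable {𝔸 : Type} [NormedRing 𝔸] [NormedAlgebra ℂ 𝔸] [CompleteSpace 𝔸]
variable {ι : Type} [Fintype ι] (b : Module.Basis ι ℝ 𝔸)

set_option maxHeartbeats 3200000 in
/-- ★★★ **COROLLARY 3.6 AT ONE COVER CUBE, BOND SECTOR, READ ON ALL THE MEMBER's BLOCKS — THE FOUR (3.42) BLOCK MAJORANTS OF `O_□` WITH THE MEMBER's COVARIANT BOND DERIVATIVES,
KEYED BY `y(b₋)`, SECTION-FREE** (MODULO the flat right entry `hR` at `(B₂, ρ′)`, as p38's `eBlock_locLetterBY`): there are `δ > 0`, `B₀ ≥ 0`, thresholds `M₀, N₀, T₀` and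
`a₁ > 0` — functions of `d, L, b₀, b₁, M₂, b` only — such that for every member above threshold, every cover cube □, every (3.35) cube datum `(u, U, A; Q, C, ξ, Λ)` of G-F6a's
form with `sRead C Λ ≤ a₁`, `u` a bi-contraction, every walk datum `(Rr, Hp)`, every `B₂ ≥ 0`, `0 < ρ′ ≤ δ` with `GVK(Ṽ_□)·conj b(∇*_{1,ν}) ≺ B₂·Lⁿη·e^{−ρ′d_□}` over the cube
sequence's blocks: `Δ_{a,□}(Ṽ_□)` is a unit AND, over `toB6 (geoBK i) Rr Hp` keyed `(b, j) ↦ y(b₋)`, `conj b(O_□) ≺ B₀(1+B₂)ℓ(a)²e^{−(1−9∕5000)ρ′d}`,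
`conj b(∇_{U,ν})·conj b(O_□) ≺ B₀(1+B₂)ℓ(a)e^{−…}`, `conj b(O_□)·conj b(∇*_{U,ν}) ≺ B₀(1+B₂)ℓ(a)e^{−…}` (all `ν`), `conj b(Δ_U)·conj b(O_□) ≺ B₀(1+B₂)·1·e^{−…}`.
[cite: Balaban1985BackgroundPropagators, Cor. 3.6 p.408, (3.87)–(3.89) p.409, p.410 l.14–15, Thm 3.3 p.399 with Thm 3.1 (3.42) p.397, Thm 3.4 p.400, (3.31) p.395, (3.100) p.413, (3.35) p.396; Balaban1984PropagatorsII, (2.39)–(2.44) pp.229–230, (2.51)–(2.55) p.232, (2.45)–(2.46) p.231, p.248] -/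
theorem hasMajorant_locLetterBY_blocks [NormOneClass 𝔸] [DecidableEq ι] (hℓ : 1 ≤ ℓ) (hb₀ : 0 < b₀) (hb₁ : b₀ ≤ b₁) (M₂ : ℝ) (hM₂ : 0 ≤ M₂)
    (hrepr : ∀ (v : 𝔸) (j : ι), |b.repr v j| ≤ M₂ * ‖v‖) :
    ∃ δ B₀ M₀ T₀ : ℝ, ∃ N₀ : ℕ, 0 < δ ∧ 0 ≤ B₀ ∧ ∃ a₁ : ℝ, 0 < a₁ ∧
    ∀ (i : KIdx d ℓ hd hL b₀ b₁) (c : ↥(cubes (toKT i).D.toDomains)),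
      M₀ ≤ ((ℓ : ℝ) + 1) * (toKT i).Mh → N₀ + 1 ≤ (toKT i).R * ((ℓ + 1) * (toKT i).Mh) → T₀ ≤ RM1 i →
    ∀ (u : GaugeY 𝔸 i) (U : CfgY 𝔸 i) (A : AfldY 𝔸 i) (Q : Set (Site (PV d ℓ i.m i.K hd hL) 0)) (C ξ Λ : ℝ),
      0 ≤ C → 0 < ξ → 1 ≤ Λ → ξ ≤ 5 * (SC i c : ℝ) * (kGeo i).eta → LatticeNorms.scaleLen ((ℓ : ℝ) + 1) (kGeo i).eta (c.1.1 + 1) ≤ Λ * ξ →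
      (∀ x : Site (PV d ℓ i.m i.K hd hL) 0, NearC i c (35 * SC i c / 8 + 1) (boxEquiv i.hN x).1 → x ∈ Q) →
      (∀ (κ : Fin (d + 1)) (x : Site (PV d ℓ i.m i.K hd hL) 0), x ∈ Q → x.shift κ ∈ Q → gaugeY i u U κ x = fluct (kGeo i).eta A κ x) →
      (∀ κ, ∀ x ∈ Q, ‖A κ x‖ ≤ C * ξ⁻¹) →
      (∀ μ ν, ∀ x ∈ Q, ‖(((kGeo i).eta : ℂ)⁻¹) • covD (shiftsV1 (PV d ℓ i.m i.K hd hL)) (fun _ _ => (1 : 𝔸ˣ)) μ (A ν) x‖ ≤ C * (ξ ^ 2)⁻¹) →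
      (∀ (t : ℝ) (κ : Fin (d + 1)) (x : Site (PV d ℓ i.m i.K hd hL) 0), ‖NormedSpace.exp ((Complex.I * (t : ℂ)) • A κ x)‖ ≤ 1) →
      sRead C Λ ≤ a₁ →
      (∀ x, ‖((u x : 𝔸ˣ) : 𝔸)‖ ≤ 1 ∧ ‖(((u x)⁻¹ : 𝔸ˣ) : 𝔸)‖ ≤ 1) →
    ∀ [Fintype (geoBK i).Site] (Rr : ℝ) (Hp : Prop) (B₂ ρ' : ℝ), 0 ≤ B₂ → 0 < ρ' → ρ' ≤ δ →
      (∀ ν : Fin (d + 1), HasMajorant (g := toB6 (geoCK i c) Rr Hp) (blkBK i c)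
        (GVK b i c (parSymY i) (parBY i) (locCfgY i c (kGeo i).eta A) * conj b (cdsBₗ i (fun _ _ => (1 : 𝔸ˣ)) ν))
        (fun a a' => B₂ * (geoCK i c).len a * Real.exp (-(ρ' * (geoCK i c).dist a a')))) →
      IsUnit (deltaACubeY i c (parSymY i) (parBY i) (locCfgY i c (kGeo i).eta A)) ∧
      HasMajorant (g := toB6 (geoBK i) Rr Hp) (fun p : FBondY i × ι => blkV1 i.hN i.D p.1) (conj b (GmemB i c u A))
        (fun a a' => B₀ * (1 + B₂) * (geoBK i).len a ^ 2 * Real.exp (-((1 - 9 / 5000) * ρ' * (geoBK i).dist a a'))) ∧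
      (∀ μ : Fin (d + 1), HasMajorant (g := toB6 (geoBK i) Rr Hp) (fun p : FBondY i × ι => blkV1 i.hN i.D p.1)
        (conj b (cdBₗ i U μ) * conj b (GmemB i c u A))
        (fun a a' => B₀ * (1 + B₂) * (geoBK i).len a * Real.exp (-((1 - 9 / 5000) * ρ' * (geoBK i).dist a a')))) ∧
      (∀ μ : Fin (d + 1), HasMajorant (g := toB6 (geoBK i) Rr Hp) (fun p : FBondY i × ι => blkV1 i.hN i.D p.1)
        (conj b (GmemB i c u A) * conj b (cdsBₗ i U μ))
        (fun a a' => B₀ * (1 + B₂) * (geoBK i).len a * Real.exp (-((1 - 9 / 5000) * ρ' * (geoBK i).dist a a')))) ∧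
      HasMajorant (g := toB6 (geoBK i) Rr Hp) (fun p : FBondY i × ι => blkV1 i.hN i.D p.1)
        (conj b (lapBₗ i U) * conj b (GmemB i c u A))
        (fun a a' => B₀ * (1 + B₂) * 1 * Real.exp (-((1 - 9 / 5000) * ρ' * (geoBK i).dist a a'))) := by
  classical
  have hD1 := D1_nonneg contDiff_thetaProf hasCompactSupport_thetaProf
  have hD2 := D2_nonneg contDiff_thetaProf hasCompactSupport_thetaProf
  obtain ⟨δ, Bf, M₀, T₀, N₀, hδ, hBf, a₁, ha₁, Hc⟩ := B9Cor36GCubeEntriesAtV.cor36_G_cube_entries_at_locCfg' b hℓ hb₀ hb₁ M₂ hM₂ hrepr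
  -- the constants: `P = (M₂Σ‖b_j‖)²`, `Λ4 = L⁴`, one constant per entry (the `∇*`-entry's at `B₂ = 0`), `Bc₀` their sum
  obtain ⟨P, hP⟩ : ∃ P : ℝ, P = (M₂ * ∑ j, ‖b j‖) ^ 2 := ⟨_, rfl⟩
  have hP0 : 0 ≤ P := by rw [hP]; positivity
  obtain ⟨Λ4, hΛ4⟩ : ∃ Λ4 : ℝ, Λ4 = ((ℓ : ℝ) + 1) ^ 4 := ⟨_, rfl⟩
  have hΛ40 : 0 ≤ Λ4 := by rw [hΛ4]; positivity
  obtain ⟨C0, hC0⟩ : ∃ C0 : ℝ, C0 = P * (1 * 1 * Bf) := ⟨_, rfl⟩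
  obtain ⟨C1, hC1⟩ : ∃ C1 : ℝ, C1 = P * (1 * 1 * Bf) + P * (D1 thetaProf / 4 * 1 * Bf) := ⟨_, rfl⟩
  obtain ⟨C2, hC2⟩ : ∃ C2 : ℝ, C2 = P * (1 * 1 * Bf) + P * (1 * (D1 thetaProf / 4) * Bf * Λ4) := ⟨_, rfl⟩
  obtain ⟨C3, hC3⟩ : ∃ C3 : ℝ, C3 = P * (1 * 1 * Bf) +
      ((d : ℝ) + 1) * (P * (D1 thetaProf / 4 * 1 * Bf) + P * (D1 thetaProf / 4 * 1 * Bf) + P * (3 * D2 thetaProf / 16 * 1 * Bf)) := ⟨_, rfl⟩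
  have hC00 : 0 ≤ C0 := by rw [hC0]; positivity
  have hC10 : 0 ≤ C1 := by rw [hC1]; positivity
  have hC20 : 0 ≤ C2 := by rw [hC2]; positivity
  have hC30 : 0 ≤ C3 := by rw [hC3]; positivity
  obtain ⟨Bc₀, hBc₀⟩ : ∃ Bc₀ : ℝ, Bc₀ = C0 + C1 + C2 + C3 := ⟨_, rfl⟩
  have hBc₀0 : 0 ≤ Bc₀ := by rw [hBc₀]; positivity
  refine ⟨δ, Bc₀ + P, M₀, max T₀ (4 * Real.log ((ℓ : ℝ) + 1) / (9 / 5000 * δ)), N₀, hδ, add_nonneg hBc₀0 hP0, a₁, ha₁, ?_⟩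
  intro i c hM hN hT u U A Q C ξ Λ hC hξ hΛ hξS hΛξ hQ hgA hA hdA hAu hsa hg _ Rr Hp B₂ ρ' hB₂ hρ' hρ'δ hR
  have hT₀ : T₀ ≤ RM1 i := (le_max_left _ _).trans hT
  have hTS : 4 * Real.log ((ℓ : ℝ) + 1) / (9 / 5000 * δ) ≤ RM1 i := (le_max_right _ _).trans hT
  obtain ⟨hunit, E0, E1, E1s, E3, E2t⟩ := Hc i c Rr Hp hM hN hT₀ A Q C ξ Λ hC hξ hΛ hξS hΛξ hQ hA hdA hAu hsa
  refine ⟨hunit, ?_⟩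
  -- the table constant at this `B₂`
  obtain ⟨Bc, hBc⟩ : ∃ Bc : ℝ, Bc = (Bc₀ + P) * (1 + B₂) := ⟨_, rfl⟩
  have hPB : 0 ≤ P * B₂ := mul_nonneg hP0 hB₂
  have hBcge : Bc₀ + P * B₂ ≤ Bc := by rw [hBc]; nlinarith [mul_nonneg hBc₀0 hB₂]
  have hBc0 : 0 ≤ Bc := by rw [hBc]; positivity
  have hc0 : C0 ≤ Bc := by rw [hBc₀] at hBcge; linarith
  have hc1 : C1 ≤ Bc := by rw [hBc₀] at hBcge; linarith
  have hc2 : P * (1 * 1 * (B₂ + Bf)) + P * (1 * (D1 thetaProf / 4) * Bf * Λ4) ≤ Bc := by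
    have e : P * (1 * 1 * (B₂ + Bf)) + P * (1 * (D1 thetaProf / 4) * Bf * Λ4) = C2 + P * B₂ := by rw [hC2]; ring
    rw [e]; rw [hBc₀] at hBcge; linarith
  have hc3 : C3 ≤ Bc := by rw [hBc₀] at hBcge; linarith
  -- the final rate
  have hδE0 : 0 < (1 - 9 / 5000) * ρ' := by positivity
  have hδEρ : (1 - 9 / 5000) * ρ' ≤ ρ' := by nlinarith
  have hδEδ : (1 - 9 / 5000) * ρ' ≤ δ := hδEρ.trans hρ'δ
  have hδEt : (1 - 9 / 5000) * ρ' ≤ (1 - 9 / 5000) * δ := by nlinarith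
  -- the inputs of the bond sandwich transfer (T3B)
  have hγ : ∀ (f : FBondY i) (a : 𝔸), ‖R (gBondY i u f) a‖ ≤ ‖a‖ ∧ ‖R (gBondY i u f)⁻¹ a‖ ≤ ‖a‖ := fun f a =>
    ⟨B9Eq310Hermitian.norm_R_le (hg _).1 (hg _).2 a, B9Eq310Hermitian.norm_R_inv_le (hg _).1 (hg _).2 a⟩
  have hNz := nearC_of_chiY_ne_zero₃ i c
  have hAG := agree_near i c (kGeo i).eta hQ hgA
  have hST := (hST_geoCK i c hδ hTS (9 / 5000) le_rfl).2.2.1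
  have hl : ∀ a : (geoBK i).Site, 0 ≤ (geoBK i).len a := fun a => (geoBK_len_pos i a).le
  -- the cube entries in the form `conj b (X * GinB)`, `conj b (GinB * X)`
  set V := locCfgY i c (kGeo i).eta A with hVdef
  have E0' : HasMajorant (g := toB6 (geoCK i c) Rr Hp) (blkBK i c) (conj b (GinB i c A))
      (fun a a' => Bf * (geoCK i c).len a ^ 2 * Real.exp (-(δ * (geoCK i c).dist a a'))) := E0
  have E1' : ∀ μ : Fin (d + 1), HasMajorant (g := toB6 (geoCK i c) Rr Hp) (blkBK i c) (conj b (cdBₗ i V μ * GinB i c A))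
      (fun a a' => Bf * (geoCK i c).len a ^ 1 * Real.exp (-(δ * (geoCK i c).dist a a'))) := fun μ => by
    simpa only [pow_one, B9Eq352DivFormLetters.conj_mul, conj_GinB] using E1 μ
  have E1s' : ∀ μ : Fin (d + 1), HasMajorant (g := toB6 (geoCK i c) Rr Hp) (blkBK i c) (conj b (cdsBₗ i V μ * GinB i c A))
      (fun a a' => Bf * (geoCK i c).len a ^ 1 * Real.exp (-(δ * (geoCK i c).dist a a'))) := fun μ => by
    simpa only [pow_one, B9Eq352DivFormLetters.conj_mul, conj_GinB] using E1s μ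
  have E2' : ∀ μ : Fin (d + 1), HasMajorant (g := toB6 (geoCK i c) Rr Hp) (blkBK i c) (conj b (GinB i c A * cdsBₗ i V μ))
      (fun a a' => (B₂ + Bf) * (geoCK i c).len a ^ 1 * Real.exp (-(ρ' * (geoCK i c).dist a a'))) := fun μ => by
    simpa only [pow_one, B9Eq352DivFormLetters.conj_mul, conj_GinB] using E2t μ B₂ ρ' hB₂ hρ'.le hρ'δ (hR μ)
  have E3' : HasMajorant (g := toB6 (geoCK i c) Rr Hp) (blkBK i c) (conj b (lapBₗ i V * GinB i c A))
      (fun a a' => Bf * (geoCK i c).len a ^ 0 * Real.exp (-(δ * (geoCK i c).dist a a'))) := by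
    simpa only [pow_zero, B9Eq352DivFormLetters.conj_mul, conj_GinB] using E3
  -- the multiplier sizes (p33's FILE 7b-D1, read at `f₋`) and the supports (`NearH`)
  have hχ : ∀ f : FBondY i, |hBdY i (chiY i c) f| ≤ 1 := fun f => (abs_chiY_le_one i c _).1
  have hχ0 : ∀ f : FBondY i, |hBdY i (chiY i c) f| * (geoCK i c).len (blkCubeY i c (chartY i f.src)) ^ 0 ≤ 1 := fun f => by
    rw [pow_zero, mul_one]; exact hχ f
  have hχp : ∀ (μ : Fin (d + 1)) (f : FBondY i), |hBdY i (fun z => chiY i c (shiftY i μ z)) f| ≤ 1 := fun μ f =>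
    (chiY_weights i c μ (chartY i f.src)).2.1
  have hχp0 : ∀ (μ : Fin (d + 1)) (f : FBondY i), |hBdY i (fun z => chiY i c (shiftY i μ z)) f| * (geoCK i c).len (blkCubeY i c (chartY i f.src)) ^ 0 ≤ 1 :=
    fun μ f => by rw [pow_zero, mul_one]; exact hχp μ f
  have hdp1 : ∀ (μ : Fin (d + 1)) (f : FBondY i),
      |hBdY i (fun z => i.cf * (chiY i c (shiftY i μ z) - chiY i c z)) f| * (geoCK i c).len (blkCubeY i c (chartY i f.src)) ^ 1 ≤ D1 thetaProf / 4 :=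
    fun μ f => by simp only [hBdY_apply, pow_one]; rw [abs_cf_mul]; exact (chiY_weights i c μ (chartY i f.src)).2.2.2.1
  have hdp1' : ∀ (μ : Fin (d + 1)) (f : FBondY i),
      |hBdY i (fun z => i.cf * (chiY i c (shiftY i μ z) - chiY i c z)) f| * (geoCK i c).len (blkCubeY i c (chartY i f.src)) ≤ D1 thetaProf / 4 :=
    fun μ f => by simp only [hBdY_apply]; rw [abs_cf_mul]; exact (chiY_weights i c μ (chartY i f.src)).2.2.2.1
  have hdm1 : ∀ (μ : Fin (d + 1)) (f : FBondY i),
      |hBdY i (fun z => i.cf * (chiY i c ((shiftY i μ).symm z) - chiY i c z)) f| * (geoCK i c).len (blkCubeY i c (chartY i f.src)) ^ 1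
        ≤ D1 thetaProf / 4 :=
    fun μ f => by simp only [hBdY_apply, pow_one]; rw [abs_cf_mul]; exact (chiY_weights i c μ (chartY i f.src)).2.2.2.2.1
  have hdd2 : ∀ (μ : Fin (d + 1)) (f : FBondY i),
      |hBdY i (fun z => i.cf ^ 2 * (chiY i c (shiftY i μ z) - 2 * chiY i c z + chiY i c ((shiftY i μ).symm z))) f|
        * (geoCK i c).len (blkCubeY i c (chartY i f.src)) ^ 2 ≤ 3 * D2 thetaProf / 16 :=
    fun μ f => by simp only [hBdY_apply]; rw [abs_cf_sq_mul]; exact (chiY_weights i c μ (chartY i f.src)).2.2.2.2.2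
  have hnχ : ∀ f : FBondY i, hBdY i (chiY i c) f ≠ 0 → NearH c (chartY i f.src).1 := fun f hf =>
    nearH_of_chiY_ne_zero₃ i c 0 (chartY i f.src) (Or.inl hf)
  have hnχp : ∀ (μ : Fin (d + 1)) (f : FBondY i), hBdY i (fun z => chiY i c (shiftY i μ z)) f ≠ 0 → NearH c (chartY i f.src).1 := fun μ f hf =>
    nearH_of_chiY_ne_zero₃ i c μ (chartY i f.src) (Or.inr (Or.inl hf))
  have hndn : ∀ (μ : Fin (d + 1)) (f : FBondY i), hBdY i (fun z => i.cf * (chiY i c (shiftY i μ z) - chiY i c z)) f ≠ 0 → NearH c (chartY i f.src).1 := by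
    intro μ f hf
    refine nearH_of_chiY_ne_zero₃ i c μ (chartY i f.src) ?_
    by_contra hcon
    simp only [not_or, not_ne_iff] at hcon
    exact hf (by simp only [hBdY_apply]; rw [hcon.1, hcon.2.1, sub_self, mul_zero])
  -- (3.42)₁: `O_□ = Sand(χ, G_□, χ)`
  have W0 : HasMajorant (g := toB6 (geoBK i) Rr Hp) (fun p : FBondY i × ι => blkV1 i.hN i.D p.1) (conj b (GmemB i c u A))
      (fun a a' => Bc * (geoBK i).len a ^ 2 * Real.exp (-((1 - 9 / 5000) * ρ' * (geoBK i).dist a a'))) := by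
    have T := hasMajorant_conj_bond_sandwich_decay_blocks i c b hM₂ hrepr (gBondY i u) hγ (hBdY i (chiY i c)) (hBdY i (chiY i c)) (c₁ := 1) (c₂ := 1)
      zero_le_one zero_le_one (m := 0) (n := 2) (by norm_num) hχ0 hχ hnχ Rr Hp Rr Hp hBf hδ.le (GinB i c A) E0'
    refine hasMajorant_mono (g := toB6 (geoBK i) Rr Hp) _ T fun a a' => ?_
    rw [← hP, ← hC0]
    exact kernel_le (geoBK_dist_nonneg i a a') (pow_nonneg (hl a) _) (le_of_eq (by norm_num)) hc0 hBc0 hδEδ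
  -- (3.42)₂: `∇_{U,μ}·O_□`
  have W1 : ∀ μ : Fin (d + 1), HasMajorant (g := toB6 (geoBK i) Rr Hp) (fun p : FBondY i × ι => blkV1 i.hN i.D p.1)
      (conj b (cdBₗ i U μ) * conj b (GmemB i c u A))
      (fun a a' => Bc * (geoBK i).len a * Real.exp (-((1 - 9 / 5000) * ρ' * (geoBK i).dist a a'))) := by
    intro μ
    have Ta := hasMajorant_conj_bond_sandwich_decay_blocks i c b hM₂ hrepr (gBondY i u) hγ (hBdY i (fun z => chiY i c (shiftY i μ z))) (hBdY i (chiY i c))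
      (c₁ := 1) (c₂ := 1) zero_le_one zero_le_one (m := 0) (n := 1) (by norm_num) (hχp0 μ) hχ hnχ Rr Hp Rr Hp hBf hδ.le
      (cdBₗ i V μ * GinB i c A) (E1' μ)
    have Tb := hasMajorant_conj_bond_sandwich_decay_blocks i c b hM₂ hrepr (gBondY i u) hγ
      (hBdY i (fun z => i.cf * (chiY i c (shiftY i μ z) - chiY i c z))) (hBdY i (chiY i c)) (c₁ := D1 thetaProf / 4) (c₂ := 1) (by positivity)
      zero_le_one (m := 1) (n := 2) (by norm_num) (hdp1 μ) hχ hnχ Rr Hp Rr Hp hBf hδ.le (GinB i c A) E0'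
    have hs := hasMajorant_congr_op (T' := conj b (cdBₗ i U μ) * conj b (GmemB i c u A)) (hasMajorant_add _ Ta Tb)
      (by rw [← B9Eq352DivFormLetters.conj_mul, cdBₗ_mul_GmemB i c u U A hNz hAG μ, conj_add])
    refine hasMajorant_mono (g := toB6 (geoBK i) Rr Hp) _ hs fun a a' => ?_
    have hd := geoBK_dist_nonneg i a a'
    calc (M₂ * ∑ j, ‖b j‖) ^ 2 * (1 * 1 * Bf) * (geoBK i).len a ^ (1 - 0) * Real.exp (-(δ * (geoBK i).dist a a'))
          + (M₂ * ∑ j, ‖b j‖) ^ 2 * (D1 thetaProf / 4 * 1 * Bf) * (geoBK i).len a ^ (2 - 1) * Real.exp (-(δ * (geoBK i).dist a a'))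
        ≤ P * (1 * 1 * Bf) * (geoBK i).len a * Real.exp (-((1 - 9 / 5000) * ρ' * (geoBK i).dist a a'))
          + P * (D1 thetaProf / 4 * 1 * Bf) * (geoBK i).len a * Real.exp (-((1 - 9 / 5000) * ρ' * (geoBK i).dist a a')) := by
          rw [hP]
          exact add_le_add (kernel_le hd (pow_nonneg (hl a) _) (le_of_eq (by norm_num)) le_rfl (by positivity) hδEδ)
            (kernel_le hd (pow_nonneg (hl a) _) (le_of_eq (by norm_num)) le_rfl (by positivity) hδEδ)
      _ = C1 * (geoBK i).len a * Real.exp (-((1 - 9 / 5000) * ρ' * (geoBK i).dist a a')) := by rw [hC1]; ring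
      _ ≤ Bc * (geoBK i).len a * Real.exp (-((1 - 9 / 5000) * ρ' * (geoBK i).dist a a')) :=
          mul_le_mul_of_nonneg_right (mul_le_mul_of_nonneg_right hc1 (hl a)) (Real.exp_nonneg _)
  -- (3.42)₃: `O_□·∇*_{U,μ}`
  have W2 : ∀ μ : Fin (d + 1), HasMajorant (g := toB6 (geoBK i) Rr Hp) (fun p : FBondY i × ι => blkV1 i.hN i.D p.1)
      (conj b (GmemB i c u A) * conj b (cdsBₗ i U μ))
      (fun a a' => Bc * (geoBK i).len a * Real.exp (-((1 - 9 / 5000) * ρ' * (geoBK i).dist a a'))) := by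
    intro μ
    have Ta := hasMajorant_conj_bond_sandwich_decay_blocks i c b hM₂ hrepr (gBondY i u) hγ (hBdY i (chiY i c)) (hBdY i (fun z => chiY i c (shiftY i μ z)))
      (c₁ := 1) (c₂ := 1) zero_le_one zero_le_one (m := 0) (n := 1) (by norm_num) hχ0 (hχp μ) (hnχp μ) Rr Hp Rr Hp (add_nonneg hB₂ hBf) hρ'.le
      (GinB i c A * cdsBₗ i V μ) (E2' μ)
    have Tb := hasMajorant_conj_bond_sandwich_decay_src_blocks i c b hM₂ hrepr (gBondY i u) hγ (hBdY i (chiY i c))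
      (hBdY i (fun z => i.cf * (chiY i c (shiftY i μ z) - chiY i c z))) (c₁ := 1) (c₂ := D1 thetaProf / 4) zero_le_one (by positivity)
      hχ (hdp1' μ) (hndn μ) Rr Hp Rr Hp hBf hδ.le (by norm_num : (9 : ℝ) / 5000 ≤ 1) hΛ40
      (by rw [hΛ4]; exact hST) (GinB i c A) E0'
    have hs := hasMajorant_congr_op (T' := conj b (GmemB i c u A) * conj b (cdsBₗ i U μ)) (hasMajorant_add _ Ta Tb)
      (by rw [← B9Eq352DivFormLetters.conj_mul, GmemB_mul_cdsBₗ i c u U A hNz hAG μ, conj_add])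
    refine hasMajorant_mono (g := toB6 (geoBK i) Rr Hp) _ hs fun a a' => ?_
    have hd := geoBK_dist_nonneg i a a'
    calc (M₂ * ∑ j, ‖b j‖) ^ 2 * (1 * 1 * (B₂ + Bf)) * (geoBK i).len a ^ (1 - 0) * Real.exp (-(ρ' * (geoBK i).dist a a'))
          + (M₂ * ∑ j, ‖b j‖) ^ 2 * (1 * (D1 thetaProf / 4) * Bf * Λ4) * (geoBK i).len a *
            Real.exp (-((1 - 9 / 5000) * δ * (geoBK i).dist a a'))
        ≤ P * (1 * 1 * (B₂ + Bf)) * (geoBK i).len a * Real.exp (-((1 - 9 / 5000) * ρ' * (geoBK i).dist a a'))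
          + P * (1 * (D1 thetaProf / 4) * Bf * Λ4) * (geoBK i).len a * Real.exp (-((1 - 9 / 5000) * ρ' * (geoBK i).dist a a')) := by
          rw [hP]
          exact add_le_add (kernel_le hd (pow_nonneg (hl a) _) (le_of_eq (by norm_num)) le_rfl (by positivity) hδEρ)
            (kernel_le hd (hl a) le_rfl le_rfl (by positivity) hδEt)
      _ = (P * (1 * 1 * (B₂ + Bf)) + P * (1 * (D1 thetaProf / 4) * Bf * Λ4)) * (geoBK i).len a *
            Real.exp (-((1 - 9 / 5000) * ρ' * (geoBK i).dist a a')) := by ring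
      _ ≤ Bc * (geoBK i).len a * Real.exp (-((1 - 9 / 5000) * ρ' * (geoBK i).dist a a')) :=
          mul_le_mul_of_nonneg_right (mul_le_mul_of_nonneg_right hc2 (hl a)) (Real.exp_nonneg _)
  -- (3.42)₄: `Δ_U·O_□`
  have W3 : HasMajorant (g := toB6 (geoBK i) Rr Hp) (fun p : FBondY i × ι => blkV1 i.hN i.D p.1)
      (conj b (lapBₗ i U) * conj b (GmemB i c u A))
      (fun a a' => Bc * 1 * Real.exp (-((1 - 9 / 5000) * ρ' * (geoBK i).dist a a'))) := by
    have T0 := hasMajorant_conj_bond_sandwich_decay_blocks i c b hM₂ hrepr (gBondY i u) hγ (hBdY i (chiY i c)) (hBdY i (chiY i c)) (c₁ := 1) (c₂ := 1)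
      zero_le_one zero_le_one (m := 0) (n := 0) le_rfl hχ0 hχ hnχ Rr Hp Rr Hp hBf hδ.le (lapBₗ i V * GinB i c A) E3'
    have Ta := fun μ : Fin (d + 1) => hasMajorant_conj_bond_sandwich_decay_blocks i c b hM₂ hrepr (gBondY i u) hγ
      (hBdY i (fun z => i.cf * (chiY i c ((shiftY i μ).symm z) - chiY i c z))) (hBdY i (chiY i c)) (c₁ := D1 thetaProf / 4) (c₂ := 1)
      (by positivity) zero_le_one (m := 1) (n := 1) le_rfl (hdm1 μ) hχ hnχ Rr Hp Rr Hp hBf hδ.le (cdsBₗ i V μ * GinB i c A) (E1s' μ)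
    have Tb := fun μ : Fin (d + 1) => hasMajorant_conj_bond_sandwich_decay_blocks i c b hM₂ hrepr (gBondY i u) hγ
      (hBdY i (fun z => i.cf * (chiY i c (shiftY i μ z) - chiY i c z))) (hBdY i (chiY i c)) (c₁ := D1 thetaProf / 4) (c₂ := 1)
      (by positivity) zero_le_one (m := 1) (n := 1) le_rfl (hdp1 μ) hχ hnχ Rr Hp Rr Hp hBf hδ.le (cdBₗ i V μ * GinB i c A) (E1' μ)
    have Tc := fun μ : Fin (d + 1) => hasMajorant_conj_bond_sandwich_decay_blocks i c b hM₂ hrepr (gBondY i u) hγ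
      (hBdY i (fun z => i.cf ^ 2 * (chiY i c (shiftY i μ z) - 2 * chiY i c z + chiY i c ((shiftY i μ).symm z)))) (hBdY i (chiY i c))
      (c₁ := 3 * D2 thetaProf / 16) (c₂ := 1) (by positivity) zero_le_one (m := 2) (n := 2) le_rfl (hdd2 μ) hχ hnχ Rr Hp Rr Hp hBf
      hδ.le (GinB i c A) E0'
    have Tsum := hasMajorant_finset_sum (g := toB6 (geoBK i) Rr Hp) (fun p : FBondY i × ι => blkV1 i.hN i.D p.1) Finset.univ _ _
      fun μ _ => hasMajorant_add _ (hasMajorant_add _ (Ta μ) (Tb μ)) (Tc μ)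
    have hs0 := hasMajorant_add _ T0 (hasMajorant_neg _ Tsum)
    rw [← sub_eq_add_neg] at hs0
    have hs := hasMajorant_congr_op (T' := conj b (lapBₗ i U) * conj b (GmemB i c u A)) hs0 (by
      rw [← B9Eq352DivFormLetters.conj_mul, lapBₗ_mul_GmemB i c u U A hNz hAG, conj_sub, conj_finset_sum]
      simp only [conj_add, SandB, hVdef])
    refine hasMajorant_mono (g := toB6 (geoBK i) Rr Hp) _ hs fun a a' => ?_
    have hd := geoBK_dist_nonneg i a a'
    have per : ∀ μ : Fin (d + 1),
        (M₂ * ∑ j, ‖b j‖) ^ 2 * (D1 thetaProf / 4 * 1 * Bf) * (geoBK i).len a ^ (1 - 1) * Real.exp (-(δ * (geoBK i).dist a a'))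
          + (M₂ * ∑ j, ‖b j‖) ^ 2 * (D1 thetaProf / 4 * 1 * Bf) * (geoBK i).len a ^ (1 - 1) * Real.exp (-(δ * (geoBK i).dist a a'))
          + (M₂ * ∑ j, ‖b j‖) ^ 2 * (3 * D2 thetaProf / 16 * 1 * Bf) * (geoBK i).len a ^ (2 - 2) * Real.exp (-(δ * (geoBK i).dist a a'))
        ≤ (P * (D1 thetaProf / 4 * 1 * Bf) + P * (D1 thetaProf / 4 * 1 * Bf) + P * (3 * D2 thetaProf / 16 * 1 * Bf)) * 1 *
            Real.exp (-((1 - 9 / 5000) * ρ' * (geoBK i).dist a a')) := by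
      intro μ
      rw [hP]
      calc _ ≤ (M₂ * ∑ j, ‖b j‖) ^ 2 * (D1 thetaProf / 4 * 1 * Bf) * 1 * Real.exp (-((1 - 9 / 5000) * ρ' * (geoBK i).dist a a'))
            + (M₂ * ∑ j, ‖b j‖) ^ 2 * (D1 thetaProf / 4 * 1 * Bf) * 1 * Real.exp (-((1 - 9 / 5000) * ρ' * (geoBK i).dist a a'))
            + (M₂ * ∑ j, ‖b j‖) ^ 2 * (3 * D2 thetaProf / 16 * 1 * Bf) * 1 * Real.exp (-((1 - 9 / 5000) * ρ' * (geoBK i).dist a a')) :=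
            add_le_add (add_le_add (kernel_le hd (pow_nonneg (hl a) _) (le_of_eq (by norm_num)) le_rfl (by positivity) hδEδ)
              (kernel_le hd (pow_nonneg (hl a) _) (le_of_eq (by norm_num)) le_rfl (by positivity) hδEδ))
              (kernel_le hd (pow_nonneg (hl a) _) (le_of_eq (by norm_num)) le_rfl (by positivity) hδEδ)
        _ = _ := by ring
    calc (M₂ * ∑ j, ‖b j‖) ^ 2 * (1 * 1 * Bf) * (geoBK i).len a ^ (0 - 0) * Real.exp (-(δ * (geoBK i).dist a a'))
          + ∑ μ : Fin (d + 1),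
            ((M₂ * ∑ j, ‖b j‖) ^ 2 * (D1 thetaProf / 4 * 1 * Bf) * (geoBK i).len a ^ (1 - 1) * Real.exp (-(δ * (geoBK i).dist a a'))
              + (M₂ * ∑ j, ‖b j‖) ^ 2 * (D1 thetaProf / 4 * 1 * Bf) * (geoBK i).len a ^ (1 - 1) * Real.exp (-(δ * (geoBK i).dist a a'))
              + (M₂ * ∑ j, ‖b j‖) ^ 2 * (3 * D2 thetaProf / 16 * 1 * Bf) * (geoBK i).len a ^ (2 - 2) * Real.exp (-(δ * (geoBK i).dist a a')))
        ≤ P * (1 * 1 * Bf) * 1 * Real.exp (-((1 - 9 / 5000) * ρ' * (geoBK i).dist a a'))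
          + ∑ _μ : Fin (d + 1), (P * (D1 thetaProf / 4 * 1 * Bf) + P * (D1 thetaProf / 4 * 1 * Bf) + P * (3 * D2 thetaProf / 16 * 1 * Bf)) * 1 *
            Real.exp (-((1 - 9 / 5000) * ρ' * (geoBK i).dist a a')) := by
          refine add_le_add ?_ (Finset.sum_le_sum fun μ _ => per μ)
          rw [hP]
          exact kernel_le hd (pow_nonneg (hl a) _) (le_of_eq (by norm_num)) le_rfl (by positivity) hδEδ
      _ = C3 * 1 * Real.exp (-((1 - 9 / 5000) * ρ' * (geoBK i).dist a a')) := by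
          rw [Finset.sum_const, Finset.card_univ, Fintype.card_fin, nsmul_eq_mul, hC3]; push_cast; ring
      _ ≤ Bc * 1 * Real.exp (-((1 - 9 / 5000) * ρ' * (geoBK i).dist a a')) :=
          mul_le_mul_of_nonneg_right (mul_le_mul_of_nonneg_right hc3 zero_le_one) (Real.exp_nonneg _)
  rw [hBc] at W0 W1 W2 W3
  exact ⟨W0, W1, W2, W3⟩

/-- ★★★ **THE SAME WITH THE FLAT RIGHT ENTRY DISCHARGED — NO DISPLAYED OPERATOR INPUT** (the section-free twin of p38's `eBlock_locLetterBY''`: lit-balaban's L-ASM + L-DIV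
`cor36_G_cube_rightEntry_at_locCfg'` supplies `hR` at `(ρ_R, B₂)`, rate-weakened to `ρ′ := min δ ρ_R`): there are `δ > 0`, `B₀ ≥ 0`, thresholds `M₀, N₀, T₀` and `a₁ > 0` such
that for every member above threshold, every cover cube □, every (3.35) cube datum `(u, U, A; Q, C, ξ, Λ)` of G-F6a's form with `sRead C Λ ≤ a₁`, `u` a bi-contraction and
every walk datum `(Rr, Hp)`: `Δ_{a,□}(Ṽ_□)` is a unit AND the four (3.42) bond block majorants of `O_□ = locLetterBY i □ parSymY parBY u χ_□ Ṽ_□` with the member's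
derivatives over `toB6 (geoBK i) Rr Hp` keyed `(b, j) ↦ y(b₋)`, kernels `B₀·ℓ(a)^{2,1,1,0}·e^{−δd}` — the h0–h3 of `B9Local342GOfBlocksXBK` for EVERY member.
[cite: Balaban1985BackgroundPropagators, Cor. 3.6 p.408, (3.87)–(3.89) p.409, p.410 l.14–15, Thm 3.3 p.399 with Thm 3.1 (3.42) p.397, Thm 3.4 p.400, (3.86) p.407, (3.31) p.395, (3.100) p.413; Balaban1984PropagatorsII, (2.39)–(2.44) pp.229–230, (2.51)–(2.55) p.232, p.248] -/
theorem hasMajorant_locLetterBY_blocks'' [NormOneClass 𝔸] [DecidableEq ι] (hℓ : 1 ≤ ℓ) (hb₀ : 0 < b₀) (hb₁ : b₀ ≤ b₁) (M₂ : ℝ) (hM₂ : 0 ≤ M₂)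
    (hrepr : ∀ (v : 𝔸) (j : ι), |b.repr v j| ≤ M₂ * ‖v‖) :
    ∃ δ B₀ M₀ T₀ : ℝ, ∃ N₀ : ℕ, 0 < δ ∧ 0 ≤ B₀ ∧ ∃ a₁ : ℝ, 0 < a₁ ∧
    ∀ (i : KIdx d ℓ hd hL b₀ b₁) (c : ↥(cubes (toKT i).D.toDomains)),
      M₀ ≤ ((ℓ : ℝ) + 1) * (toKT i).Mh → N₀ + 1 ≤ (toKT i).R * ((ℓ + 1) * (toKT i).Mh) → T₀ ≤ RM1 i →
    ∀ (u : GaugeY 𝔸 i) (U : CfgY 𝔸 i) (A : AfldY 𝔸 i) (Q : Set (Site (PV d ℓ i.m i.K hd hL) 0)) (C ξ Λ : ℝ),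
      0 ≤ C → 0 < ξ → 1 ≤ Λ → ξ ≤ 5 * (SC i c : ℝ) * (kGeo i).eta → LatticeNorms.scaleLen ((ℓ : ℝ) + 1) (kGeo i).eta (c.1.1 + 1) ≤ Λ * ξ →
      (∀ x : Site (PV d ℓ i.m i.K hd hL) 0, NearC i c (35 * SC i c / 8 + 1) (boxEquiv i.hN x).1 → x ∈ Q) →
      (∀ (κ : Fin (d + 1)) (x : Site (PV d ℓ i.m i.K hd hL) 0), x ∈ Q → x.shift κ ∈ Q → gaugeY i u U κ x = fluct (kGeo i).eta A κ x) →
      (∀ κ, ∀ x ∈ Q, ‖A κ x‖ ≤ C * ξ⁻¹) →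
      (∀ μ ν, ∀ x ∈ Q, ‖(((kGeo i).eta : ℂ)⁻¹) • covD (shiftsV1 (PV d ℓ i.m i.K hd hL)) (fun _ _ => (1 : 𝔸ˣ)) μ (A ν) x‖ ≤ C * (ξ ^ 2)⁻¹) →
      (∀ (t : ℝ) (κ : Fin (d + 1)) (x : Site (PV d ℓ i.m i.K hd hL) 0), ‖NormedSpace.exp ((Complex.I * (t : ℂ)) • A κ x)‖ ≤ 1) →
      sRead C Λ ≤ a₁ →
      (∀ x, ‖((u x : 𝔸ˣ) : 𝔸)‖ ≤ 1 ∧ ‖(((u x)⁻¹ : 𝔸ˣ) : 𝔸)‖ ≤ 1) →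
    ∀ [Fintype (geoBK i).Site] (Rr : ℝ) (Hp : Prop),
      IsUnit (deltaACubeY i c (parSymY i) (parBY i) (locCfgY i c (kGeo i).eta A)) ∧
      HasMajorant (g := toB6 (geoBK i) Rr Hp) (fun p : FBondY i × ι => blkV1 i.hN i.D p.1) (conj b (GmemB i c u A))
        (fun a a' => B₀ * (geoBK i).len a ^ 2 * Real.exp (-(δ * (geoBK i).dist a a'))) ∧
      (∀ μ : Fin (d + 1), HasMajorant (g := toB6 (geoBK i) Rr Hp) (fun p : FBondY i × ι => blkV1 i.hN i.D p.1)
        (conj b (cdBₗ i U μ) * conj b (GmemB i c u A))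
        (fun a a' => B₀ * (geoBK i).len a * Real.exp (-(δ * (geoBK i).dist a a')))) ∧
      (∀ μ : Fin (d + 1), HasMajorant (g := toB6 (geoBK i) Rr Hp) (fun p : FBondY i × ι => blkV1 i.hN i.D p.1)
        (conj b (GmemB i c u A) * conj b (cdsBₗ i U μ))
        (fun a a' => B₀ * (geoBK i).len a * Real.exp (-(δ * (geoBK i).dist a a')))) ∧
      HasMajorant (g := toB6 (geoBK i) Rr Hp) (fun p : FBondY i × ι => blkV1 i.hN i.D p.1)
        (conj b (lapBₗ i U) * conj b (GmemB i c u A))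
        (fun a a' => B₀ * 1 * Real.exp (-(δ * (geoBK i).dist a a'))) := by
  -- the tables modulo `hR`
  obtain ⟨δ₆, B₆, M₆, T₆, N₆, hδ₆, hB₆, a₆, ha₆, h6⟩ := hasMajorant_locLetterBY_blocks b hℓ hb₀ hb₁ M₂ hM₂ hrepr
  -- the right entry, closed (L-ASM + L-DIV)
  obtain ⟨ρR, B₂, MR, TR, NR, hρR, hB₂, aR, haR, hR⟩ := cor36_G_cube_rightEntry_at_locCfg' b hℓ hb₀ hb₁ M₂ hM₂ hrepr
  set ρ' : ℝ := min δ₆ ρR with hρ'def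
  have hρ' : 0 < ρ' := lt_min hδ₆ hρR
  have hρ'δ : ρ' ≤ δ₆ := min_le_left _ _
  have hρ'R : ρ' ≤ ρR := min_le_right _ _
  refine ⟨(1 - 9 / 5000) * ρ', B₆ * (1 + B₂), max M₆ MR, max T₆ TR, max N₆ NR, by positivity, by positivity, min a₆ aR, lt_min ha₆ haR, ?_⟩
  intro i c hM hN hT u U A Q C ξ Λ hC hξ hΛ hξS hΛξ hQ hgA hA hdA hAu hsa hg _ Rr Hp
  have hM₆ : M₆ ≤ ((ℓ : ℝ) + 1) * (toKT i).Mh := (le_max_left _ _).trans hM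
  have hMR : MR ≤ ((ℓ : ℝ) + 1) * (toKT i).Mh := (le_max_right _ _).trans hM
  have hN₆ : N₆ + 1 ≤ (toKT i).R * ((ℓ + 1) * (toKT i).Mh) := le_trans (Nat.succ_le_succ (le_max_left _ _)) hN
  have hNR : NR + 1 ≤ (toKT i).R * ((ℓ + 1) * (toKT i).Mh) := le_trans (Nat.succ_le_succ (le_max_right _ _)) hN
  have hT₆ : T₆ ≤ RM1 i := (le_max_left _ _).trans hT
  have hTR : TR ≤ RM1 i := (le_max_right _ _).trans hT
  have hs₆ : sRead C Λ ≤ a₆ := hsa.trans (min_le_left _ _)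
  have hsR : sRead C Λ ≤ aR := hsa.trans (min_le_right _ _)
  obtain ⟨hdnn, -, -, -⟩ := geoCK_dist_axioms i c Rr Hp
  -- the right entry at `(ρ_R, B₂)`, rate-weakened to `ρ′`
  have hRν : ∀ ν : Fin (d + 1), HasMajorant (g := toB6 (geoCK i c) Rr Hp) (blkBK i c)
      (GVK b i c (parSymY i) (parBY i) (locCfgY i c (kGeo i).eta A) * conj b (cdsBₗ i (fun _ _ => (1 : 𝔸ˣ)) ν))
      (fun a a' => B₂ * (geoCK i c).len a * Real.exp (-(ρ' * (geoCK i c).dist a a'))) := fun ν =>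
    hasMajorant_mono (g := toB6 (geoCK i c) Rr Hp) _ (hR i c Rr Hp hMR hNR hTR A Q C ξ Λ hC hξ hΛ hξS hΛξ hQ hA hdA hAu hsR ν) fun a a' =>
      kernel_rate_mono hdnn hρ'R (mul_nonneg hB₂ (geoCK_len_pos i c a).le) a a'
  exact h6 i c hM₆ hN₆ hT₆ u U A Q C ξ Λ hC hξ hΛ hξS hΛξ hQ hgA hA hdA hAu hs₆ hg Rr Hp B₂ ρ' hB₂ hρ' hρ'δ hRν

end Literature.MathematicalPhysics.QuantumFieldTheory.Balaban1983to89.B9Cor36GCubeLocAtBlocks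

end
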